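import Literature.AlgebraicGeometry.Motives.HodgeStructureCentralizerDiagonalAction
import Literature.AlgebraicGeometry.Motives.HodgeStructureCentralizerBaseChange
import HarnessLib

/-!
# «CANONICAL ISOMORPHISMS `C'(A) ≅ C(A) ⊗_k k'`» ARE FUNCTORIAL: an isomorphism of Milne centralizers `e : C(H₁) ≃ₐ[ℚ] C(H₂)`
# base-changes to `E : C(H₁)(K) ≃ₐ[K] C(H₂)(K)`, `E(k · γ_K) = k · (e γ)_K`, carrying every linear intertwining identity and the
# adjoints along; hence, ON `K`-POINTS AND WITH THEIR FORMULAS, «the diagonal action of `C(A)` on `rV(A)` identifies `C(A)` with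
# `C(A^r)`» and the canonical block `C(S)(K) ⥲ C(U)(K)` by restriction (Milne 1999 §1 p. 643 L12–L13, Remark 1.6)

[topic AlgebraicGeometry/Motives]

Layer `Literature/AlgebraicGeometry/Motives`, lane `lit-hodgefound` (Track 2 foundations library; prover seat
`lit-hodgefound-p02`, generation 53, self-proposed row g53-#8). THEOREMS ONLY: no definition, no named fact (net debt `0`),
no instance, no notation.  The `K`-points companion of g53-#3 (`Motives/HodgeStructureCentralizerDiagonalAction`: the
`ℚ`-isomorphisms `C(H₀) ≃ₐ C(⊕ᵢ Tᵢ)` — diagonal action — and `C(S) ≃ₐ C(U)` — restriction — with their formulas), obtained by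
transporting them through Remark 1.6 in the canonical form of g53-#5 (`Motives/HodgeStructureCentralizerBaseChange`:
`K ⊗_ℚ C(H) ≃ₐ[K] C(H)(K)`, `k ⊗ γ ↦ k · γ_K`), exactly as g53-#6 transports Prop. 1.1.  g52-#9 ∕ #10 have the `K`-point
isomorphisms only as bare `Nonempty` (`Motives/HodgeStructureCentralizerIsotypicBlockPoints` and kin); here they come with the
formulas that make them «canonical».  Joins BY NAME p34's `K`-adjoint `Polarization.adjointBaseChange` ∕ `Polarization.centralizerAdjoint`
(`Motives/HodgeStructurePolarizationAdjointPoints`, `…EndAlgCentralizerInvolutionMatrixPairs`); nothing restated.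

## The source, verbatim

J. S. Milne, *Lefschetz classes on abelian varieties*, Duke Math. J. 96 (1999) 639–675 [Milne1999LefschetzClasses] (held
`paper:doi-10-1215-s0012-7094-99-09620-5`), §1 p. 643 L12–L13: "For any positive integer `r`, `V(A^r) = rV(A)`, and the diagonal
action of `C(A)` on `rV(A)` identifies `C(A)` with `C(A^r)` (as `k`-algebras with involution)."; p. 644 L29–L34: "**Remark 1.6.** If
`X → H*(X)` is a Weil cohomology theory with coefficient field `k`, and `k'` is a field containing `k`, then `X → H*(X) ⊗_k k'` is a
Weil cohomology theory with coefficient field `k'`. If `C'(A)` and `S'(A)` denote the objects defined relative to the second theory,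
then there are canonical isomorphisms `C'(A) ≅ C(A) ⊗_k k'`, `S'(A) ≅ S(A)_{/k'}`."  Base change of homomorphism modules:
N. Bourbaki, *Algebra I* [BourbakiAlgebraI1989] Ch. II §5 no. 3 Prop. 7 and formulas (17)–(18); also D. Huybrechts [Huybrechts2016K3]
§3.3.5, C. Voisin [VoisinHodgeI2002] §7.3.1 Lemma 7.26.

## Dictionary and what is proved (namespace `Literature.AlgebraicGeometry.Motives.HodgeStructure`)

`C(H) = Subalgebra.centralizer ℚ E_φ(H)`, `C(H)(K) = Subalgebra.centralizer K {a_K : a ∈ E_φ(H)} ⊆ End_K(K ⊗_ℚ V)`, `γ_K = γ.baseChange K`,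
`†_K = Q.adjointBaseChange K` (on `C(H)(K)`: `Q.centralizerAdjoint K`).

* §1 (any `e : C(H₁) ≃ₐ[ℚ] C(H₂)`) **`exists_centralizer_baseChange_algEquiv_of_algEquiv`** (`∃ E : C(H₁)(K) ≃ₐ[K] C(H₂)(K)` with
  `E c = k · (e γ)_K` whenever `c = k · γ_K`), `centralizer_baseChange_linearMap_eq_of_forall_eq_smul_baseChange` («canonical»: a
  `K`-linear map out of `C(H₁)(K)` is determined on the `k · γ_K`), **`baseChange_comp_coe_comp_baseChange_eq_of_forall`** (such an `E`
  carries every identity `A ∘ (e γ) ∘ B = C ∘ γ ∘ D` of `ℚ`-linear maps to `A_K ∘ (E c) ∘ B_K = C_K ∘ c ∘ D_K`),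
  **`Polarization.coe_map_centralizerAdjoint_eq_adjointBaseChange_of_forall_eq_smul_baseChange`** (if `e(γ^{†₁}) = (e γ)^{†₂}` then
  `E(c^{†₁_K}) = (E c)^{†₂_K}` — «as `k`-algebras with involution»).
* §2 (internal `V' = ⊕ᵢ Tᵢ`, Hodge isomorphisms `rᵢ : H₀ ⥲ Tᵢ`, `Rᵢ = ιᵢ ∘ rᵢ : W₀ → V'`)
  `linearMap_eq_of_forall_apply_baseChange_hom_eq` (the `(Rᵢ)_K (K ⊗ W₀)` span `K ⊗ V'`),
  `centralizer_baseChange_map_eq_of_forall_apply_baseChange_eq` (UNIQUENESS of a map acting diagonally on `K`-points),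
  **`exists_centralizer_baseChange_algEquiv_apply_baseChange_eq [Nonempty ι]`** (THE DIAGONAL ACTION ON `K`-POINTS:
  `∃ E : C(H₀)(K) ≃ₐ[K] C(H')(K), (E c) ((Rᵢ)_K x) = (Rᵢ)_K (c x)`, with `E(c^{†_K}) = (E c)^{†_K}` for ANY polarizations `ψ₀, ψ'`),
  `Polarization.coe_map_centralizerAdjoint_eq_adjointBaseChange_of_forall_apply_baseChange_eq` (ANY diagonal map respects `†_K`).
* §3 (polarizable `H`, `S` minimal non-zero `E_φ`-stable, `U ≤ S` irreducible, `j = Submodule.inclusion : U ↪ S`)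
  `centralizer_baseChange_map_eq_of_forall_subtype_baseChange_apply_eq` (uniqueness of a map over the restriction),
  **`exists_centralizer_baseChange_algEquiv_subtype_baseChange_apply_eq_of_minimal_stable`** (THE CANONICAL BLOCK ON `K`-POINTS:
  `∃ E : C(S)(K) ≃ₐ[K] C(U)(K), (ι_U)_K ((E c) x) = (ι_S)_K (c (j_K x))`),
  `Polarization.exists_centralizer_baseChange_algEquiv_subtype_baseChange_apply_eq_adjoint_of_minimal_stable` (with
  `E(c^{†_K}) = (E c)^{†_K}` for `ψ|_S`, `ψ|_U`), `existsUnique_centralizer_baseChange_forall_subtype_baseChange_apply_eq_of_minimal_stable`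
  (every `d ∈ C(U)(K)` is the restriction of a unique `c ∈ C(S)(K)`).
-/

noncomputable section

open scoped TensorProduct

namespace Literature.AlgebraicGeometry.Motives

namespace HodgeStructure

universe u u' uK

variable (K : Type uK) [Field K] [Algebra ℚ K] {n : ℤ}

/-! ## §1 Base change of an isomorphism of centralizers along Remark 1.6 -/

section BaseChangeOfIso

variable {V₁ : Type u} [AddCommGroup V₁] [Module ℚ V₁] [Module.Finite ℚ V₁] {n₁ : ℤ} {H₁ : HodgeStructure V₁ n₁}
  {V₂ : Type u'} [AddCommGroup V₂] [Module ℚ V₂] [Module.Finite ℚ V₂] {n₂ : ℤ} {H₂ : HodgeStructure V₂ n₂}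

/-- **An isomorphism `e : C(H₁) ≃ₐ[ℚ] C(H₂)` of Milne centralizers BASE-CHANGES to `E : C(H₁)(K) ≃ₐ[K] C(H₂)(K)` with
`E(k · γ_K) = k · (e γ)_K`** — `E = κ₂ ∘ (K ⊗ e) ∘ κ₁⁻¹` for the canonical `κᵢ : K ⊗_ℚ C(Hᵢ) ⥲ C(Hᵢ)(K)`, `k ⊗ γ ↦ k · γ_K`, of Remark 1.6
(g53-#5). [cite: Milne1999LefschetzClasses, §1 Remark 1.6 (p. 644)] [cite: BourbakiAlgebraI1989, Ch. II §5 no. 3 Prop. 7] -/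
theorem exists_centralizer_baseChange_algEquiv_of_algEquiv
    (e : Subalgebra.centralizer ℚ (H₁.endAlg : Set (Module.End ℚ V₁)) ≃ₐ[ℚ] Subalgebra.centralizer ℚ (H₂.endAlg : Set (Module.End ℚ V₂))) :
    ∃ E : Subalgebra.centralizer K ((fun a : Module.End ℚ V₁ => a.baseChange K) '' (H₁.endAlg : Set (Module.End ℚ V₁))) ≃ₐ[K]
        Subalgebra.centralizer K ((fun a : Module.End ℚ V₂ => a.baseChange K) '' (H₂.endAlg : Set (Module.End ℚ V₂))),
      ∀ (c : Subalgebra.centralizer K ((fun a : Module.End ℚ V₁ => a.baseChange K) '' (H₁.endAlg : Set (Module.End ℚ V₁))))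
        (k : K) (γ : Subalgebra.centralizer ℚ (H₁.endAlg : Set (Module.End ℚ V₁))),
        (c : Module.End K (K ⊗[ℚ] V₁)) = k • (γ : Module.End ℚ V₁).baseChange K →
          ((E c : Subalgebra.centralizer K ((fun a : Module.End ℚ V₂ => a.baseChange K) '' (H₂.endAlg : Set (Module.End ℚ V₂)))) :
              Module.End K (K ⊗[ℚ] V₂)) =
            k • ((e γ : Subalgebra.centralizer ℚ (H₂.endAlg : Set (Module.End ℚ V₂))) : Module.End ℚ V₂).baseChange K := by
  obtain ⟨e₁, he₁⟩ := exists_baseChange_centralizer_algEquiv K H₁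
  obtain ⟨e₂, he₂⟩ := exists_baseChange_centralizer_algEquiv K H₂
  refine ⟨e₁.symm.trans ((Algebra.TensorProduct.congr (AlgEquiv.refl : K ≃ₐ[K] K) e).trans e₂), fun c k γ hc => ?_⟩
  have hc' : c = e₁ (k ⊗ₜ[ℚ] γ) := Subtype.ext (by rw [hc, he₁])
  rw [hc', AlgEquiv.trans_apply, AlgEquiv.symm_apply_apply, AlgEquiv.trans_apply, Algebra.TensorProduct.congr_apply,
    Algebra.TensorProduct.map_tmul, he₂]
  simp only [AlgEquiv.coe_toAlgHom, AlgEquiv.coe_refl, id_eq]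

/-- **«Canonical»: a `K`-linear map out of `C(H₁)(K)` is determined by its values on the `k · γ_K`, `γ ∈ C(H₁)`** (they span
`C(H₁)(K) = K ⊗_ℚ C(H₁)`). [cite: Milne1999LefschetzClasses, §1 Remark 1.6 (p. 644)] [cite: BourbakiAlgebraI1989, Ch. II §5 no. 3 Prop. 7] -/
theorem centralizer_baseChange_linearMap_eq_of_forall_eq_smul_baseChange {M : Type*} [AddCommMonoid M] [Module K M]
    (f g : Subalgebra.centralizer K ((fun a : Module.End ℚ V₁ => a.baseChange K) '' (H₁.endAlg : Set (Module.End ℚ V₁))) →ₗ[K] M)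
    (h : ∀ (c : Subalgebra.centralizer K ((fun a : Module.End ℚ V₁ => a.baseChange K) '' (H₁.endAlg : Set (Module.End ℚ V₁))))
      (k : K) (γ : Subalgebra.centralizer ℚ (H₁.endAlg : Set (Module.End ℚ V₁))),
      (c : Module.End K (K ⊗[ℚ] V₁)) = k • (γ : Module.End ℚ V₁).baseChange K → f c = g c) :
    f = g := by
  obtain ⟨e₁, he₁⟩ := exists_baseChange_centralizer_algEquiv K H₁
  refine LinearMap.ext fun c => ?_
  obtain ⟨y, rfl⟩ := e₁.surjective c
  induction y using TensorProduct.induction_on with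
  | zero => rw [map_zero, map_zero, map_zero]
  | add y y' hy hy' => rw [map_add, map_add, map_add, hy, hy']
  | tmul k γ => exact h _ k γ (he₁ k γ)

omit [Module.Finite ℚ V₂] in
/-- **The base-changed isomorphism carries every linear intertwining identity along**: if `E : C(H₁)(K) ≃ₐ[K] C(H₂)(K)` satisfies
`E(k · γ_K) = k · (e γ)_K` and `ℚ`-linear maps `A, B, C, D` satisfy `A ∘ (e γ) ∘ B = C ∘ γ ∘ D` for all `γ ∈ C(H₁)`, then
`A_K ∘ (E c) ∘ B_K = C_K ∘ c ∘ D_K` for all `c ∈ C(H₁)(K)` — both sides are `K`-linear in `c` and agree on `c = k · γ_K`, where they are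
`k · (A ∘ e γ ∘ B)_K = k · (C ∘ γ ∘ D)_K` (finite-dimensionality of `V₂` is not used).
[cite: Milne1999LefschetzClasses, §1 Remark 1.6 (p. 644)] [cite: BourbakiAlgebraI1989, Ch. II §5 no. 3 (17)–(18)] -/
theorem baseChange_comp_coe_comp_baseChange_eq_of_forall {X : Type*} {Y : Type*} [AddCommGroup X] [Module ℚ X]
    [AddCommGroup Y] [Module ℚ Y]
    (e : Subalgebra.centralizer ℚ (H₁.endAlg : Set (Module.End ℚ V₁)) ≃ₐ[ℚ] Subalgebra.centralizer ℚ (H₂.endAlg : Set (Module.End ℚ V₂)))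
    (E : Subalgebra.centralizer K ((fun a : Module.End ℚ V₁ => a.baseChange K) '' (H₁.endAlg : Set (Module.End ℚ V₁))) ≃ₐ[K]
      Subalgebra.centralizer K ((fun a : Module.End ℚ V₂ => a.baseChange K) '' (H₂.endAlg : Set (Module.End ℚ V₂))))
    (hE : ∀ (c : Subalgebra.centralizer K ((fun a : Module.End ℚ V₁ => a.baseChange K) '' (H₁.endAlg : Set (Module.End ℚ V₁))))
      (k : K) (γ : Subalgebra.centralizer ℚ (H₁.endAlg : Set (Module.End ℚ V₁))),
      (c : Module.End K (K ⊗[ℚ] V₁)) = k • (γ : Module.End ℚ V₁).baseChange K →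
        ((E c : Subalgebra.centralizer K ((fun a : Module.End ℚ V₂ => a.baseChange K) '' (H₂.endAlg : Set (Module.End ℚ V₂)))) :
            Module.End K (K ⊗[ℚ] V₂)) =
          k • ((e γ : Subalgebra.centralizer ℚ (H₂.endAlg : Set (Module.End ℚ V₂))) : Module.End ℚ V₂).baseChange K)
    (A : V₂ →ₗ[ℚ] Y) (B : X →ₗ[ℚ] V₂) (C : V₁ →ₗ[ℚ] Y) (D : X →ₗ[ℚ] V₁)
    (h : ∀ γ : Subalgebra.centralizer ℚ (H₁.endAlg : Set (Module.End ℚ V₁)),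
      A ∘ₗ ((e γ : Subalgebra.centralizer ℚ (H₂.endAlg : Set (Module.End ℚ V₂))) : Module.End ℚ V₂) ∘ₗ B =
        C ∘ₗ (γ : Module.End ℚ V₁) ∘ₗ D)
    (c : Subalgebra.centralizer K ((fun a : Module.End ℚ V₁ => a.baseChange K) '' (H₁.endAlg : Set (Module.End ℚ V₁)))) :
    A.baseChange K ∘ₗ ((E c : Subalgebra.centralizer K ((fun a : Module.End ℚ V₂ => a.baseChange K) ''
        (H₂.endAlg : Set (Module.End ℚ V₂)))) : Module.End K (K ⊗[ℚ] V₂)) ∘ₗ B.baseChange K =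
      C.baseChange K ∘ₗ (c : Module.End K (K ⊗[ℚ] V₁)) ∘ₗ D.baseChange K := by
  obtain ⟨e₁, he₁⟩ := exists_baseChange_centralizer_algEquiv K H₁
  obtain ⟨y, rfl⟩ := e₁.surjective c
  induction y using TensorProduct.induction_on with
  | zero => simp only [map_zero, ZeroMemClass.coe_zero, LinearMap.zero_comp, LinearMap.comp_zero]
  | add y y' hy hy' => simp only [map_add, AddMemClass.coe_add, LinearMap.add_comp, LinearMap.comp_add, hy, hy']
  | tmul k γ =>
    rw [hE _ k γ (he₁ k γ), he₁, LinearMap.smul_comp, LinearMap.comp_smul, LinearMap.smul_comp, LinearMap.comp_smul,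
      ← LinearMap.baseChange_comp, ← LinearMap.baseChange_comp, ← LinearMap.baseChange_comp, ← LinearMap.baseChange_comp, h]

/-- **«As `k`-algebras with involution», on `K`-points**: if `e : C(H₁) ≃ₐ[ℚ] C(H₂)` carries `†₁` to `†₂` (`e(γ^{†₁}) = (e γ)^{†₂}`),
then its base change `E` (`E(k · γ_K) = k · (e γ)_K`) carries the `K`-adjoint `†₁,K` of `ψ₁` to that of `ψ₂`:
`E(c^{†₁,K}) = (E c)^{†₂,K}` — on `c = k · γ_K`, `c^{†_K} = k · (γ†)_K` (p34's `adjointBaseChange_baseChange`).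
[cite: Milne1999LefschetzClasses, §1 p. 643 L12–L13 («as k-algebras with involution») and Remark 1.6 (p. 644)] [cite: Huybrechts2016K3, §3.3.5 eq. (3.3)] -/
theorem Polarization.coe_map_centralizerAdjoint_eq_adjointBaseChange_of_forall_eq_smul_baseChange
    (ψ₁ : Polarization H₁) (ψ₂ : Polarization H₂)
    (e : Subalgebra.centralizer ℚ (H₁.endAlg : Set (Module.End ℚ V₁)) ≃ₐ[ℚ] Subalgebra.centralizer ℚ (H₂.endAlg : Set (Module.End ℚ V₂)))
    (he : ∀ γ : Subalgebra.centralizer ℚ (H₁.endAlg : Set (Module.End ℚ V₁)),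
      ((e ⟨ψ₁.adjoint γ, ψ₁.adjoint_mem_centralizer_endAlg γ.2⟩ : Subalgebra.centralizer ℚ (H₂.endAlg : Set (Module.End ℚ V₂))) :
          Module.End ℚ V₂) =
        ψ₂.adjoint ((e γ : Subalgebra.centralizer ℚ (H₂.endAlg : Set (Module.End ℚ V₂))) : Module.End ℚ V₂))
    (E : Subalgebra.centralizer K ((fun a : Module.End ℚ V₁ => a.baseChange K) '' (H₁.endAlg : Set (Module.End ℚ V₁))) ≃ₐ[K]
      Subalgebra.centralizer K ((fun a : Module.End ℚ V₂ => a.baseChange K) '' (H₂.endAlg : Set (Module.End ℚ V₂))))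
    (hE : ∀ (c : Subalgebra.centralizer K ((fun a : Module.End ℚ V₁ => a.baseChange K) '' (H₁.endAlg : Set (Module.End ℚ V₁))))
      (k : K) (γ : Subalgebra.centralizer ℚ (H₁.endAlg : Set (Module.End ℚ V₁))),
      (c : Module.End K (K ⊗[ℚ] V₁)) = k • (γ : Module.End ℚ V₁).baseChange K →
        ((E c : Subalgebra.centralizer K ((fun a : Module.End ℚ V₂ => a.baseChange K) '' (H₂.endAlg : Set (Module.End ℚ V₂)))) :
            Module.End K (K ⊗[ℚ] V₂)) =
          k • ((e γ : Subalgebra.centralizer ℚ (H₂.endAlg : Set (Module.End ℚ V₂))) : Module.End ℚ V₂).baseChange K)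
    (c : Subalgebra.centralizer K ((fun a : Module.End ℚ V₁ => a.baseChange K) '' (H₁.endAlg : Set (Module.End ℚ V₁)))) :
    ((E (ψ₁.centralizerAdjoint K c) : Subalgebra.centralizer K ((fun a : Module.End ℚ V₂ => a.baseChange K) ''
        (H₂.endAlg : Set (Module.End ℚ V₂)))) : Module.End K (K ⊗[ℚ] V₂)) =
      ψ₂.adjointBaseChange K ((E c : Subalgebra.centralizer K ((fun a : Module.End ℚ V₂ => a.baseChange K) ''
        (H₂.endAlg : Set (Module.End ℚ V₂)))) : Module.End K (K ⊗[ℚ] V₂)) := by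
  obtain ⟨e₁, he₁⟩ := exists_baseChange_centralizer_algEquiv K H₁
  obtain ⟨y, rfl⟩ := e₁.surjective c
  have h0 : ψ₁.centralizerAdjoint K 0 = 0 :=
    Subtype.ext (by rw [Polarization.coe_centralizerAdjoint, ZeroMemClass.coe_zero, Polarization.adjointBaseChange_zero])
  have hadd : ∀ c c' : Subalgebra.centralizer K ((fun a : Module.End ℚ V₁ => a.baseChange K) '' (H₁.endAlg : Set (Module.End ℚ V₁))),
      ψ₁.centralizerAdjoint K (c + c') = ψ₁.centralizerAdjoint K c + ψ₁.centralizerAdjoint K c' := fun c c' =>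
    Subtype.ext (by
      rw [Polarization.coe_centralizerAdjoint, AddMemClass.coe_add, Polarization.adjointBaseChange_add, AddMemClass.coe_add,
        Polarization.coe_centralizerAdjoint, Polarization.coe_centralizerAdjoint])
  induction y using TensorProduct.induction_on with
  | zero => simp only [map_zero, h0, ZeroMemClass.coe_zero, Polarization.adjointBaseChange_zero]
  | add y y' hy hy' => simp only [map_add, hadd, AddMemClass.coe_add, Polarization.adjointBaseChange_add, hy, hy']
  | tmul k γ =>
    have hadj : ((ψ₁.centralizerAdjoint K (e₁ (k ⊗ₜ[ℚ] γ)) : Subalgebra.centralizer K ((fun a : Module.End ℚ V₁ => a.baseChange K) ''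
        (H₁.endAlg : Set (Module.End ℚ V₁)))) : Module.End K (K ⊗[ℚ] V₁)) =
          k • ((⟨ψ₁.adjoint γ, ψ₁.adjoint_mem_centralizer_endAlg γ.2⟩ : Subalgebra.centralizer ℚ (H₁.endAlg : Set (Module.End ℚ V₁))) :
            Module.End ℚ V₁).baseChange K := by
      rw [Polarization.coe_centralizerAdjoint, he₁, Polarization.adjointBaseChange_smul, Polarization.adjointBaseChange_baseChange]
    rw [hE _ k _ hadj, he, hE _ k γ (he₁ k γ), Polarization.adjointBaseChange_smul, Polarization.adjointBaseChange_baseChange]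

end BaseChangeOfIso

/-! ## §2 The diagonal action on `K`-points, with its formula -/

section Diagonal

variable {V' : Type u} [AddCommGroup V'] [Module ℚ V'] [Module.Finite ℚ V'] {H' : HodgeStructure V' n}
  {W₀ : Type u} [AddCommGroup W₀] [Module ℚ W₀] [Module.Finite ℚ W₀] {H₀ : HodgeStructure W₀ n}
  {ι : Type} [Fintype ι] [DecidableEq ι] (T : ι → SubHodgeStructure H')
  (hT : DirectSum.IsInternal fun i => (T i).toSubmodule)
  (r : ∀ i, Hom H₀ (T i).toHodgeStructure) (hr : ∀ i, Function.Bijective (r i).toLinearMap)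

include hT hr

omit [Module.Finite ℚ V'] [Module.Finite ℚ W₀] [Fintype ι] in
/-- **The `(Rᵢ)_K (K ⊗ W₀) = K ⊗ Tᵢ` span `K ⊗ V'`** (`Rᵢ = ιᵢ ∘ rᵢ : W₀ ⥲ Tᵢ ↪ V'`, `V' = ⊕ᵢ Tᵢ`): two `K`-linear maps out of `K ⊗ V'`
agreeing on every `(Rᵢ)_K x` are equal. [cite: Milne1999LefschetzClasses, §1 p. 643 L12–L13 and Remark 1.6] [cite: BourbakiAlgebraI1989, Ch. II §5 no. 3 Prop. 7] -/
theorem linearMap_eq_of_forall_apply_baseChange_hom_eq {M : Type*} [AddCommMonoid M] [Module K M] (f g : K ⊗[ℚ] V' →ₗ[K] M)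
    (h : ∀ (i : ι) (x : K ⊗[ℚ] W₀),
      f (((T i).toSubmodule.subtype ∘ₗ (r i).toLinearMap).baseChange K x) = g (((T i).toSubmodule.subtype ∘ₗ (r i).toLinearMap).baseChange K x)) :
    f = g := by
  refine LinearMap.ext fun x => ?_
  induction x using TensorProduct.induction_on with
  | zero => rw [map_zero, map_zero]
  | add x x' hx hx' => rw [map_add, map_add, hx, hx']
  | tmul k v =>
    -- `v = Σᵢ vᵢ`, `vᵢ = rᵢ wᵢ ∈ Tᵢ`, and `k ⊗ rᵢ wᵢ = (Rᵢ)_K (k ⊗ wᵢ)`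
    have hv : v ∈ ⨆ i, (T i).toSubmodule := by rw [hT.submodule_iSup_eq_top]; exact Submodule.mem_top
    induction hv using Submodule.iSup_induction' with
    | mem i v hv =>
      obtain ⟨w, hw⟩ := (hr i).2 ⟨v, hv⟩
      have hkv : k ⊗ₜ[ℚ] v = ((T i).toSubmodule.subtype ∘ₗ (r i).toLinearMap).baseChange K (k ⊗ₜ[ℚ] w) := by
        rw [LinearMap.baseChange_tmul, LinearMap.comp_apply, hw, Submodule.subtype_apply]
      rw [hkv, h]
    | zero => rw [TensorProduct.tmul_zero, map_zero, map_zero]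
    | add v v' _ _ hv hv' => rw [TensorProduct.tmul_add, map_add, map_add, hv, hv']

omit [Module.Finite ℚ V'] [Module.Finite ℚ W₀] [Fintype ι] in
/-- **UNIQUENESS of the diagonal action on `K`-points**: two maps `E, E' : C(H₀)(K) → C(H')(K)` which both act diagonally
(`(E c) ((Rᵢ)_K x) = (Rᵢ)_K (c x)` for all `i`, `Rᵢ = ιᵢ ∘ rᵢ`) COINCIDE — the `(Rᵢ)_K (K ⊗ W₀) = K ⊗ Tᵢ` span `K ⊗ V'`.
[cite: Milne1999LefschetzClasses, §1 p. 643 L12–L13 and Remark 1.6] -/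
theorem centralizer_baseChange_map_eq_of_forall_apply_baseChange_eq
    (E E' : Subalgebra.centralizer K ((fun a : Module.End ℚ W₀ => a.baseChange K) '' (H₀.endAlg : Set (Module.End ℚ W₀))) →
      Subalgebra.centralizer K ((fun a : Module.End ℚ V' => a.baseChange K) '' (H'.endAlg : Set (Module.End ℚ V'))))
    (hE : ∀ (c : Subalgebra.centralizer K ((fun a : Module.End ℚ W₀ => a.baseChange K) '' (H₀.endAlg : Set (Module.End ℚ W₀))))
      (i : ι) (x : K ⊗[ℚ] W₀),
      ((E c : Subalgebra.centralizer K ((fun a : Module.End ℚ V' => a.baseChange K) '' (H'.endAlg : Set (Module.End ℚ V')))) :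
          Module.End K (K ⊗[ℚ] V')) (((T i).toSubmodule.subtype ∘ₗ (r i).toLinearMap).baseChange K x) =
        ((T i).toSubmodule.subtype ∘ₗ (r i).toLinearMap).baseChange K ((c : Module.End K (K ⊗[ℚ] W₀)) x))
    (hE' : ∀ (c : Subalgebra.centralizer K ((fun a : Module.End ℚ W₀ => a.baseChange K) '' (H₀.endAlg : Set (Module.End ℚ W₀))))
      (i : ι) (x : K ⊗[ℚ] W₀),
      ((E' c : Subalgebra.centralizer K ((fun a : Module.End ℚ V' => a.baseChange K) '' (H'.endAlg : Set (Module.End ℚ V')))) :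
          Module.End K (K ⊗[ℚ] V')) (((T i).toSubmodule.subtype ∘ₗ (r i).toLinearMap).baseChange K x) =
        ((T i).toSubmodule.subtype ∘ₗ (r i).toLinearMap).baseChange K ((c : Module.End K (K ⊗[ℚ] W₀)) x)) :
    E = E' :=
  funext fun c => Subtype.ext (linearMap_eq_of_forall_apply_baseChange_hom_eq K T hT r hr _ _ fun i x => by rw [hE, hE'])

/-- **THE DIAGONAL ACTION ON `K`-POINTS, WITH ITS FORMULA** («the diagonal action of `C(A)` on `rV(A)` identifies `C(A)` with `C(A^r)`
(as `k`-algebras with involution)», read through Remark 1.6): for Hodge isomorphisms `rᵢ : H₀ ⥲ Tᵢ` onto the blocks of an internal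
direct sum `V' = ⊕ᵢ Tᵢ` (`ι` non-empty) and every field `K ⊇ ℚ` there is an isomorphism of `K`-algebras `E : C(H₀)(K) ≃ₐ[K] C(H')(K)`
acting DIAGONALLY, `(E c) ((Rᵢ)_K x) = (Rᵢ)_K (c x)` (`Rᵢ = ιᵢ ∘ rᵢ : W₀ ⥲ Tᵢ ↪ V'`), and carrying the `K`-adjoint of ANY polarization
`ψ₀` of `H₀` to that of ANY polarization `ψ'` of `H'` — the base change (§1) of g53-#3's `ℚ`-isomorphism.
[cite: Milne1999LefschetzClasses, §1 p. 643 L12–L13 and Remark 1.6 (p. 644)] [cite: Huybrechts2016K3, §3.3.5 eq. (3.3)] -/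
theorem exists_centralizer_baseChange_algEquiv_apply_baseChange_eq [Nonempty ι] :
    ∃ E : Subalgebra.centralizer K ((fun a : Module.End ℚ W₀ => a.baseChange K) '' (H₀.endAlg : Set (Module.End ℚ W₀))) ≃ₐ[K]
        Subalgebra.centralizer K ((fun a : Module.End ℚ V' => a.baseChange K) '' (H'.endAlg : Set (Module.End ℚ V'))),
      (∀ (c : Subalgebra.centralizer K ((fun a : Module.End ℚ W₀ => a.baseChange K) '' (H₀.endAlg : Set (Module.End ℚ W₀))))
          (i : ι) (x : K ⊗[ℚ] W₀),
        ((E c : Subalgebra.centralizer K ((fun a : Module.End ℚ V' => a.baseChange K) '' (H'.endAlg : Set (Module.End ℚ V')))) :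
            Module.End K (K ⊗[ℚ] V')) (((T i).toSubmodule.subtype ∘ₗ (r i).toLinearMap).baseChange K x) =
          ((T i).toSubmodule.subtype ∘ₗ (r i).toLinearMap).baseChange K ((c : Module.End K (K ⊗[ℚ] W₀)) x)) ∧
      ∀ (ψ₀ : Polarization H₀) (ψ' : Polarization H')
          (c : Subalgebra.centralizer K ((fun a : Module.End ℚ W₀ => a.baseChange K) '' (H₀.endAlg : Set (Module.End ℚ W₀)))),
        ((E (ψ₀.centralizerAdjoint K c) : Subalgebra.centralizer K ((fun a : Module.End ℚ V' => a.baseChange K) ''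
            (H'.endAlg : Set (Module.End ℚ V')))) : Module.End K (K ⊗[ℚ] V')) =
          ψ'.adjointBaseChange K ((E c : Subalgebra.centralizer K ((fun a : Module.End ℚ V' => a.baseChange K) ''
            (H'.endAlg : Set (Module.End ℚ V')))) : Module.End K (K ⊗[ℚ] V')) := by
  obtain ⟨e, he, hadj⟩ := exists_centralizer_endAlg_algEquiv_apply_hom_eq T hT r hr
  obtain ⟨E, hE⟩ := exists_centralizer_baseChange_algEquiv_of_algEquiv K e
  refine ⟨E, fun c i x => ?_, fun ψ₀ ψ' c =>
    ψ₀.coe_map_centralizerAdjoint_eq_adjointBaseChange_of_forall_eq_smul_baseChange K ψ' e (hadj ψ₀ ψ') E hE c⟩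
  -- the `ℚ`-identity `(e γ) ∘ Rᵢ = Rᵢ ∘ γ`, transported by §1
  have hq : ∀ γ : Subalgebra.centralizer ℚ (H₀.endAlg : Set (Module.End ℚ W₀)),
      LinearMap.id ∘ₗ ((e γ : Subalgebra.centralizer ℚ (H'.endAlg : Set (Module.End ℚ V'))) : Module.End ℚ V') ∘ₗ
          ((T i).toSubmodule.subtype ∘ₗ (r i).toLinearMap) =
        ((T i).toSubmodule.subtype ∘ₗ (r i).toLinearMap) ∘ₗ (γ : Module.End ℚ W₀) ∘ₗ LinearMap.id := fun γ =>
    LinearMap.ext fun w => by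
      simp only [LinearMap.id_comp, LinearMap.comp_id, LinearMap.comp_apply, Submodule.subtype_apply]
      exact he γ i w
  have h := LinearMap.congr_fun (baseChange_comp_coe_comp_baseChange_eq_of_forall K e E hE LinearMap.id
    ((T i).toSubmodule.subtype ∘ₗ (r i).toLinearMap) ((T i).toSubmodule.subtype ∘ₗ (r i).toLinearMap) LinearMap.id hq c) x
  simpa only [LinearMap.baseChange_id, LinearMap.id_comp, LinearMap.comp_id, LinearMap.comp_apply] using h

/-- **ANY map `C(H₀)(K) → C(H')(K)` acting diagonally respects the `K`-adjoints**, for any polarizations `ψ₀`, `ψ'` (it is the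
isomorphism of the previous theorem, by uniqueness). [cite: Milne1999LefschetzClasses, §1 p. 643 L12–L13 and Remark 1.6 (p. 644)] -/
theorem Polarization.coe_map_centralizerAdjoint_eq_adjointBaseChange_of_forall_apply_baseChange_eq [Nonempty ι]
    (ψ₀ : Polarization H₀) (ψ' : Polarization H')
    (E' : Subalgebra.centralizer K ((fun a : Module.End ℚ W₀ => a.baseChange K) '' (H₀.endAlg : Set (Module.End ℚ W₀))) →
      Subalgebra.centralizer K ((fun a : Module.End ℚ V' => a.baseChange K) '' (H'.endAlg : Set (Module.End ℚ V'))))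
    (hE' : ∀ (c : Subalgebra.centralizer K ((fun a : Module.End ℚ W₀ => a.baseChange K) '' (H₀.endAlg : Set (Module.End ℚ W₀))))
      (i : ι) (x : K ⊗[ℚ] W₀),
      ((E' c : Subalgebra.centralizer K ((fun a : Module.End ℚ V' => a.baseChange K) '' (H'.endAlg : Set (Module.End ℚ V')))) :
          Module.End K (K ⊗[ℚ] V')) (((T i).toSubmodule.subtype ∘ₗ (r i).toLinearMap).baseChange K x) =
        ((T i).toSubmodule.subtype ∘ₗ (r i).toLinearMap).baseChange K ((c : Module.End K (K ⊗[ℚ] W₀)) x))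
    (c : Subalgebra.centralizer K ((fun a : Module.End ℚ W₀ => a.baseChange K) '' (H₀.endAlg : Set (Module.End ℚ W₀)))) :
    ((E' (ψ₀.centralizerAdjoint K c) : Subalgebra.centralizer K ((fun a : Module.End ℚ V' => a.baseChange K) ''
        (H'.endAlg : Set (Module.End ℚ V')))) : Module.End K (K ⊗[ℚ] V')) =
      ψ'.adjointBaseChange K ((E' c : Subalgebra.centralizer K ((fun a : Module.End ℚ V' => a.baseChange K) ''
        (H'.endAlg : Set (Module.End ℚ V')))) : Module.End K (K ⊗[ℚ] V')) := by
  obtain ⟨E, hE, hadj⟩ := exists_centralizer_baseChange_algEquiv_apply_baseChange_eq K T hT r hr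
  have hEE' : (E : _ → _) = E' := centralizer_baseChange_map_eq_of_forall_apply_baseChange_eq K T hT r hr E E' hE hE'
  rw [← hEE']
  exact hadj ψ₀ ψ' c

end Diagonal

/-! ## §3 The canonical block on `K`-points: restriction `C(S)(K) ⥲ C(U)(K)`, with its formula -/

section CanonicalBlock

variable {V : Type u} [AddCommGroup V] [Module ℚ V] [Module.Finite ℚ V] {H : HodgeStructure V n}
  {S U : SubHodgeStructure H} (hUS : U.toSubmodule ≤ S.toSubmodule)

include hUS

omit [Module.Finite ℚ V] in
/-- **Uniqueness of a map over the restriction on `K`-points**: two maps `E, E' : C(S)(K) → C(U)(K)` with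
`(ι_U)_K ((E c) x) = (ι_S)_K (c (j_K x))` (`j : U ↪ S` the inclusion) COINCIDE — `(ι_U)_K` is injective, `K` being flat over `ℚ`.
[cite: Milne1999LefschetzClasses, §1 p. 643 L12–L13 and Remark 1.6] [cite: BourbakiAlgebraI1989, Ch. II §5 no. 3 Prop. 7] -/
theorem centralizer_baseChange_map_eq_of_forall_subtype_baseChange_apply_eq
    (E E' : Subalgebra.centralizer K ((fun a : Module.End ℚ S.toSubmodule => a.baseChange K) ''
        (S.toHodgeStructure.endAlg : Set (Module.End ℚ S.toSubmodule))) →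
      Subalgebra.centralizer K ((fun a : Module.End ℚ U.toSubmodule => a.baseChange K) ''
        (U.toHodgeStructure.endAlg : Set (Module.End ℚ U.toSubmodule))))
    (hE : ∀ (c : Subalgebra.centralizer K ((fun a : Module.End ℚ S.toSubmodule => a.baseChange K) ''
        (S.toHodgeStructure.endAlg : Set (Module.End ℚ S.toSubmodule)))) (x : K ⊗[ℚ] U.toSubmodule),
      U.toSubmodule.subtype.baseChange K
          (((E c : Subalgebra.centralizer K ((fun a : Module.End ℚ U.toSubmodule => a.baseChange K) ''
            (U.toHodgeStructure.endAlg : Set (Module.End ℚ U.toSubmodule)))) : Module.End K (K ⊗[ℚ] U.toSubmodule)) x) =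
        S.toSubmodule.subtype.baseChange K ((c : Module.End K (K ⊗[ℚ] S.toSubmodule)) ((Submodule.inclusion hUS).baseChange K x)))
    (hE' : ∀ (c : Subalgebra.centralizer K ((fun a : Module.End ℚ S.toSubmodule => a.baseChange K) ''
        (S.toHodgeStructure.endAlg : Set (Module.End ℚ S.toSubmodule)))) (x : K ⊗[ℚ] U.toSubmodule),
      U.toSubmodule.subtype.baseChange K
          (((E' c : Subalgebra.centralizer K ((fun a : Module.End ℚ U.toSubmodule => a.baseChange K) ''
            (U.toHodgeStructure.endAlg : Set (Module.End ℚ U.toSubmodule)))) : Module.End K (K ⊗[ℚ] U.toSubmodule)) x) =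
        S.toSubmodule.subtype.baseChange K ((c : Module.End K (K ⊗[ℚ] S.toSubmodule)) ((Submodule.inclusion hUS).baseChange K x))) :
    E = E' := by
  have hinj : Function.Injective (U.toSubmodule.subtype.baseChange K) := by
    rw [LinearMap.baseChange_eq_ltensor]
    exact Module.Flat.lTensor_preserves_injective_linearMap _ U.toSubmodule.injective_subtype
  exact funext fun c => Subtype.ext (LinearMap.ext fun x => hinj (by rw [hE, hE']))

variable (hS : (∀ a ∈ H.endAlg, ∀ v ∈ S.toSubmodule, a v ∈ S.toSubmodule) ∧ S.toSubmodule ≠ ⊥ ∧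
    ∀ S' : SubHodgeStructure H, (∀ a ∈ H.endAlg, ∀ v ∈ S'.toSubmodule, a v ∈ S'.toSubmodule) →
      S'.toSubmodule ≤ S.toSubmodule → S'.toSubmodule = ⊥ ∨ S'.toSubmodule = S.toSubmodule)
  (hU : U.toHodgeStructure.IsIrreducible)

include hS hU

/-- **THE CANONICAL BLOCK ON `K`-POINTS: restriction to `K ⊗ U` is an isomorphism of `K`-algebras `E : C(S)(K) ≃ₐ[K] C(U)(K)`,
`(ι_U)_K ((E c) x) = (ι_S)_K (c (j_K x))`**, for a minimal non-zero `E_φ`-stable sub-Hodge structure `S` of a polarizable `H` and an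
irreducible `U ≤ S` (`j : U ↪ S`) — the base change (§1) of g53-#3's `ℚ`-isomorphism `C(S) ≃ₐ C(U)`, `(e γ) u = γ u`.
[cite: Milne1999LefschetzClasses, §1 p. 643 L12–L13, Prop. 1.1 and Remark 1.6 (p. 644)] [cite: VoisinHodgeI2002, §7.3.1 Lemma 7.26] -/
theorem exists_centralizer_baseChange_algEquiv_subtype_baseChange_apply_eq_of_minimal_stable (hH : H.IsPolarizable) :
    ∃ E : Subalgebra.centralizer K ((fun a : Module.End ℚ S.toSubmodule => a.baseChange K) ''
          (S.toHodgeStructure.endAlg : Set (Module.End ℚ S.toSubmodule))) ≃ₐ[K]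
        Subalgebra.centralizer K ((fun a : Module.End ℚ U.toSubmodule => a.baseChange K) ''
          (U.toHodgeStructure.endAlg : Set (Module.End ℚ U.toSubmodule))),
      ∀ (c : Subalgebra.centralizer K ((fun a : Module.End ℚ S.toSubmodule => a.baseChange K) ''
          (S.toHodgeStructure.endAlg : Set (Module.End ℚ S.toSubmodule)))) (x : K ⊗[ℚ] U.toSubmodule),
        U.toSubmodule.subtype.baseChange K
            (((E c : Subalgebra.centralizer K ((fun a : Module.End ℚ U.toSubmodule => a.baseChange K) ''
              (U.toHodgeStructure.endAlg : Set (Module.End ℚ U.toSubmodule)))) : Module.End K (K ⊗[ℚ] U.toSubmodule)) x) =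
          S.toSubmodule.subtype.baseChange K ((c : Module.End K (K ⊗[ℚ] S.toSubmodule)) ((Submodule.inclusion hUS).baseChange K x)) := by
  obtain ⟨e, he⟩ := exists_centralizer_endAlg_algEquiv_coe_apply_eq_of_minimal_stable hUS hS hU hH
  obtain ⟨E, hE⟩ := exists_centralizer_baseChange_algEquiv_of_algEquiv K e
  refine ⟨E, fun c x => ?_⟩
  -- the `ℚ`-identity `ι_U ∘ (e γ) = ι_S ∘ γ ∘ j`, transported by §1
  have hq : ∀ γ : Subalgebra.centralizer ℚ (S.toHodgeStructure.endAlg : Set (Module.End ℚ S.toSubmodule)),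
      U.toSubmodule.subtype ∘ₗ ((e γ : Subalgebra.centralizer ℚ (U.toHodgeStructure.endAlg : Set (Module.End ℚ U.toSubmodule))) :
          Module.End ℚ U.toSubmodule) ∘ₗ LinearMap.id =
        S.toSubmodule.subtype ∘ₗ (γ : Module.End ℚ S.toSubmodule) ∘ₗ Submodule.inclusion hUS := fun γ =>
    LinearMap.ext fun u => by
      rw [LinearMap.comp_id, LinearMap.comp_apply, Submodule.subtype_apply, LinearMap.comp_apply, LinearMap.comp_apply,
        Submodule.subtype_apply, he]
      rfl
  have h := LinearMap.congr_fun (baseChange_comp_coe_comp_baseChange_eq_of_forall K e E hE U.toSubmodule.subtype LinearMap.id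
    S.toSubmodule.subtype (Submodule.inclusion hUS) hq c) x
  simpa only [LinearMap.baseChange_id, LinearMap.comp_id, LinearMap.comp_apply] using h

/-- **The canonical block on `K`-points «as `k`-algebras with involution»**: the restriction isomorphism
`E : C(S)(K) ≃ₐ[K] C(U)(K)` carries the `K`-adjoint of `ψ|_S` to that of `ψ|_U`, `E(c^{†_K}) = (E c)^{†_K}`.
[cite: Milne1999LefschetzClasses, §1 p. 643 L12–L13 and Remark 1.6 (p. 644)] [cite: Huybrechts2016K3, §3.3.5 eq. (3.3)] -/
theorem Polarization.exists_centralizer_baseChange_algEquiv_subtype_baseChange_apply_eq_adjoint_of_minimal_stable (ψ : Polarization H) :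
    ∃ E : Subalgebra.centralizer K ((fun a : Module.End ℚ S.toSubmodule => a.baseChange K) ''
          (S.toHodgeStructure.endAlg : Set (Module.End ℚ S.toSubmodule))) ≃ₐ[K]
        Subalgebra.centralizer K ((fun a : Module.End ℚ U.toSubmodule => a.baseChange K) ''
          (U.toHodgeStructure.endAlg : Set (Module.End ℚ U.toSubmodule))),
      (∀ (c : Subalgebra.centralizer K ((fun a : Module.End ℚ S.toSubmodule => a.baseChange K) ''
          (S.toHodgeStructure.endAlg : Set (Module.End ℚ S.toSubmodule)))) (x : K ⊗[ℚ] U.toSubmodule),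
        U.toSubmodule.subtype.baseChange K
            (((E c : Subalgebra.centralizer K ((fun a : Module.End ℚ U.toSubmodule => a.baseChange K) ''
              (U.toHodgeStructure.endAlg : Set (Module.End ℚ U.toSubmodule)))) : Module.End K (K ⊗[ℚ] U.toSubmodule)) x) =
          S.toSubmodule.subtype.baseChange K ((c : Module.End K (K ⊗[ℚ] S.toSubmodule)) ((Submodule.inclusion hUS).baseChange K x))) ∧
      ∀ c : Subalgebra.centralizer K ((fun a : Module.End ℚ S.toSubmodule => a.baseChange K) ''
          (S.toHodgeStructure.endAlg : Set (Module.End ℚ S.toSubmodule))),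
        ((E ((ψ.restrict S).centralizerAdjoint K c) : Subalgebra.centralizer K ((fun a : Module.End ℚ U.toSubmodule =>
            a.baseChange K) '' (U.toHodgeStructure.endAlg : Set (Module.End ℚ U.toSubmodule)))) : Module.End K (K ⊗[ℚ] U.toSubmodule)) =
          (ψ.restrict U).adjointBaseChange K ((E c : Subalgebra.centralizer K ((fun a : Module.End ℚ U.toSubmodule =>
            a.baseChange K) '' (U.toHodgeStructure.endAlg : Set (Module.End ℚ U.toSubmodule)))) :
              Module.End K (K ⊗[ℚ] U.toSubmodule)) := by
  obtain ⟨e, he, hadj⟩ := ψ.exists_centralizer_endAlg_algEquiv_coe_apply_eq_adjoint_of_minimal_stable hUS hS hU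
  obtain ⟨E, hE⟩ := exists_centralizer_baseChange_algEquiv_of_algEquiv K e
  obtain ⟨E₁, hE₁⟩ := exists_centralizer_baseChange_algEquiv_subtype_baseChange_apply_eq_of_minimal_stable K hUS hS hU ⟨ψ⟩
  -- `E` acts by restriction (as `E₁` does: §1 transport of `he`), hence `E = E₁` would do; we use `E` and re-derive the formula
  have hq : ∀ γ : Subalgebra.centralizer ℚ (S.toHodgeStructure.endAlg : Set (Module.End ℚ S.toSubmodule)),
      U.toSubmodule.subtype ∘ₗ ((e γ : Subalgebra.centralizer ℚ (U.toHodgeStructure.endAlg : Set (Module.End ℚ U.toSubmodule))) :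
          Module.End ℚ U.toSubmodule) ∘ₗ LinearMap.id =
        S.toSubmodule.subtype ∘ₗ (γ : Module.End ℚ S.toSubmodule) ∘ₗ Submodule.inclusion hUS := fun γ =>
    LinearMap.ext fun u => by
      rw [LinearMap.comp_id, LinearMap.comp_apply, Submodule.subtype_apply, LinearMap.comp_apply, LinearMap.comp_apply,
        Submodule.subtype_apply, he]
      rfl
  refine ⟨E, fun c x => ?_, fun c =>
    (ψ.restrict S).coe_map_centralizerAdjoint_eq_adjointBaseChange_of_forall_eq_smul_baseChange K (ψ.restrict U) e hadj E hE c⟩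
  have h := LinearMap.congr_fun (baseChange_comp_coe_comp_baseChange_eq_of_forall K e E hE U.toSubmodule.subtype LinearMap.id
    S.toSubmodule.subtype (Submodule.inclusion hUS) hq c) x
  simpa only [LinearMap.baseChange_id, LinearMap.comp_id, LinearMap.comp_apply] using h

/-- **Every `d ∈ C(U)(K)` is the restriction of a UNIQUE `c ∈ C(S)(K)`** (bijectivity of restriction on the canonical block, on
`K`-points, spelled out). [cite: Milne1999LefschetzClasses, §1 p. 643 L12–L13, Prop. 1.1 and Remark 1.6 (p. 644)] -/
theorem existsUnique_centralizer_baseChange_forall_subtype_baseChange_apply_eq_of_minimal_stable (hH : H.IsPolarizable)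
    (d : Subalgebra.centralizer K ((fun a : Module.End ℚ U.toSubmodule => a.baseChange K) ''
      (U.toHodgeStructure.endAlg : Set (Module.End ℚ U.toSubmodule)))) :
    ∃! c : Subalgebra.centralizer K ((fun a : Module.End ℚ S.toSubmodule => a.baseChange K) ''
        (S.toHodgeStructure.endAlg : Set (Module.End ℚ S.toSubmodule))),
      ∀ x : K ⊗[ℚ] U.toSubmodule,
        U.toSubmodule.subtype.baseChange K ((d : Module.End K (K ⊗[ℚ] U.toSubmodule)) x) =
          S.toSubmodule.subtype.baseChange K ((c : Module.End K (K ⊗[ℚ] S.toSubmodule)) ((Submodule.inclusion hUS).baseChange K x)) := by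
  obtain ⟨E, hE⟩ := exists_centralizer_baseChange_algEquiv_subtype_baseChange_apply_eq_of_minimal_stable K hUS hS hU hH
  have hinj : Function.Injective (U.toSubmodule.subtype.baseChange K) := by
    rw [LinearMap.baseChange_eq_ltensor]
    exact Module.Flat.lTensor_preserves_injective_linearMap _ U.toSubmodule.injective_subtype
  refine ⟨E.symm d, fun x => ?_, fun c hc => ?_⟩
  · rw [← hE (E.symm d) x, AlgEquiv.apply_symm_apply]
  · have h : E c = d := Subtype.ext (LinearMap.ext fun x => hinj (by rw [hE, hc]))
    rw [← h, AlgEquiv.symm_apply_apply]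

end CanonicalBlock

end HodgeStructure

end Literature.AlgebraicGeometry.Motives
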